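import Summits.ABC.StewartYu.ArchG3RecLinesF
import Summits.ABC.StewartYu.ArchG3RecLinesCK
import HarnessLib

/-!
# The archimedean record `ArchG3Rec` — letter lines in closed form, file FK: THE START PRINT `cPRK κ` (κ-form)

Support file (theorems only; no named facts). Cell `abc-stewartyu`, route `YuMatveevShapeRat`, crux r2 `ArchCoreRat`
(stmt-ABC-20502), line `arch-g3-frame`, stub `stub_recLinesArch`, R50 shared atom for the family files (p5 H, p4 K (J)(C),
p2 O, p1 K/O (F)). κ-twins of file E/F's START-print chain on p5's `ArchG3RecLinesClosedK` letters (`YRK`, `logAmaxRRK`, `cPRK`)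
and p4's κ-atoms (`ArchG3RecLinesCK`):
* `logDΔCK_le κ hκ lev lev' ν'`: `log DΔC(YRK κ lev, Tf lev' ν') ≤ Tf lev' ν'·(WN + log N + log(κ·n) + 3·log(n+2) + 1)`;
* `logAmaxRRK_le`: `logAmaxRRK κ ≤ T₀·(WN + 2 log N + log(κn) + 3 log(n+2) + 10n + 30) + (23/160)·T₀·X + (14/100 + n/(4(n+1)))·Z + debris`;
* `cPRK_le κ hκ (hn : 2 ≤ n) (hlogκ : log(κ·n) ≤ X/32)`: `cPRK κ ≤ (51/25)·Z`;
* **`cPRK_two_pow_le (hn : 2 ≤ n) : cPRK (2^(n−1)) ≤ (51/25)·Z`** — unconditional (`log(2^{n−1}·n) ≤ 1.7n ≤ 2(n+1) ≤ X/32`).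

## References
* [Nesterenko2003] Yu. V. Nesterenko, LNM 1819 (2003) — §3.5 (3.37), Prop. 3.9.
-/

noncomputable section

open Finset Real
open scoped Nat
open Summit.ABC.StewartYu.ArchSupply (WC)
open Summit.ABC.StewartYu.ArchG3Setup (DΔC)

namespace Summit.ABC.StewartYu

namespace ArchG3Rec

open PadicG3Par (Cb Cb_pos)
open ArchG3Par (G K yloadK G_eq G_pos K_pos yloadK_pos two_G_le_yloadK)

variable {n : ℕ} (P : ArchG3Rec n)

/-! ### The Δ-weight (κ-form) -/

set_option maxHeartbeats 400000 in
/-- **κ-twin of `logDΔC_le`: `log DΔC(YRK κ lev, Tf lev' ν') ≤ Tf lev' ν'·(WN + log N + log(κ·n) + 3·log(n+2) + 1)`**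
(p4's `YRK_le`: `YRK ≤ 10·n·(κn)·Bexp·N²·L`). [cite: Nesterenko2003, (3.37); shape only] -/
theorem logDΔCK_le (κ : ℕ) (hκ : 1 ≤ κ) (lev lev' ν' : ℕ) : Real.log (DΔC (P.YRK κ lev) (P.Tf lev' ν')) ≤
    P.Tf lev' ν' * (P.WN + Real.log P.N + Real.log ((κ : ℝ) * n) + 3 * Real.log ((n : ℝ) + 2) + 1) := by
  obtain ⟨hY0, hY⟩ := P.YRK_le κ hκ lev
  obtain ⟨hT8, hT1⟩ := P.Tf_ge lev' ν'
  have hN := P.N_facts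
  have hL := P.L_real
  rw [ArchG3Setup.log_DΔC hY0]
  have hT0 : (0 : ℝ) < P.Tf lev' ν' := by linarith
  have hn0 : (0 : ℝ) ≤ n := Nat.cast_nonneg n
  have hn1 : (1 : ℝ) ≤ n := by exact_mod_cast P.hn
  have hf1 : (1 : ℝ) ≤ (κ : ℝ) * n := (ArchG3Rec.kappa_pred_le hκ P.hn).2.2
  have hB : Real.log P.Bexp = P.W - 1 := by unfold Bexp; rw [Real.log_exp]
  have hB1 : 1 ≤ P.Bexp := P.Alast_facts.2.2.2.2.2
  -- `YR/Tf ≤ (5/4)(n+2)^3 n! B N²`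
  have hq : P.YRK κ lev / P.Tf lev' ν' ≤ 5 / 4 * ((n : ℝ) + 2) ^ 3 * ((κ : ℝ) * n) * P.Bexp * P.N ^ 2 := by
    rw [div_le_iff₀ hT0]
    have h1 : P.YRK κ lev * ((n : ℝ) + 2) ^ 3 ≤ 10 * n * ((κ : ℝ) * n) * P.Bexp * P.N ^ 2 * P.L * ((n : ℝ) + 2) ^ 3 :=
      mul_le_mul_of_nonneg_right hY (by positivity)
    -- `10 n L ≤ (5/4)·8(n+1)L ≤ (5/4)(n+2)^3 Tf`… : `10 n n! B N² L (n+2)^3 ≤ (5/4)(n+2)^3 n! B N² · (n+2)^3 Tf`… use `8(n+1)L ≤ (n+2)^3 Tf`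
    have hc : (0 : ℝ) ≤ 5 / 4 * ((n : ℝ) + 2) ^ 3 * ((κ : ℝ) * n) * P.Bexp * P.N ^ 2 := by positivity
    have h2 := mul_le_mul_of_nonneg_left hT8 hc
    have h3 : 10 * (n : ℝ) * ((κ : ℝ) * n) * P.Bexp * P.N ^ 2 * P.L * ((n : ℝ) + 2) ^ 3 ≤
        5 / 4 * ((n : ℝ) + 2) ^ 3 * ((κ : ℝ) * n) * P.Bexp * P.N ^ 2 * (8 * ((n : ℝ) + 1) * P.L) := by
      have : 10 * (n : ℝ) ≤ 5 / 4 * (8 * ((n : ℝ) + 1)) := by linarith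
      have hc2 : (0 : ℝ) ≤ ((κ : ℝ) * n) * P.Bexp * P.N ^ 2 * P.L * ((n : ℝ) + 2) ^ 3 := by positivity
      nlinarith [mul_le_mul_of_nonneg_right this hc2]
    have hc3 : (0 : ℝ) < ((n : ℝ) + 2) ^ 3 := by positivity
    nlinarith
  have hbig : (1 : ℝ) ≤ ((n : ℝ) + 2) ^ 3 * ((κ : ℝ) * n) * P.Bexp * P.N ^ 2 := by
    have h27 : (1 : ℝ) ≤ ((n : ℝ) + 2) ^ 3 := one_le_pow₀ (by linarith)
    have hN2 : (1 : ℝ) ≤ P.N ^ 2 := one_le_pow₀ hN.2.1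
    exact one_le_mul_of_one_le_of_one_le (one_le_mul_of_one_le_of_one_le (one_le_mul_of_one_le_of_one_le h27 hf1) hB1) hN2
  have h4 : 1 + P.YRK κ lev / P.Tf lev' ν' ≤ 9 / 4 * (((n : ℝ) + 2) ^ 3 * ((κ : ℝ) * n) * P.Bexp * P.N ^ 2) := by linarith
  have h5 : Real.log (1 + P.YRK κ lev / P.Tf lev' ν') ≤
      Real.log (9 / 4) + (3 * Real.log ((n : ℝ) + 2) + Real.log ((κ : ℝ) * n) + (P.W - 1) + 2 * Real.log P.N) := by
    have hpos : 0 < 1 + P.YRK κ lev / P.Tf lev' ν' := by positivity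
    calc Real.log (1 + P.YRK κ lev / P.Tf lev' ν') ≤ Real.log (9 / 4 * (((n : ℝ) + 2) ^ 3 * ((κ : ℝ) * n) * P.Bexp * P.N ^ 2)) :=
          Real.log_le_log hpos h4
      _ = Real.log (9 / 4) + (3 * Real.log ((n : ℝ) + 2) + Real.log ((κ : ℝ) * n) + (P.W - 1) + 2 * Real.log P.N) := by
          have hB0 : P.Bexp ≠ 0 := by linarith
          have hn2 : ((n : ℝ) + 2) ^ 3 ≠ 0 := by positivity
          have hf0 : ((κ : ℝ) * n) ≠ 0 := by positivity
          have hN0 : (P.N : ℝ) ^ 2 ≠ 0 := by have := hN.1; positivity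
          rw [Real.log_mul (by norm_num) (by positivity), Real.log_mul (by positivity) hN0,
            Real.log_mul (by positivity) hB0, Real.log_mul hn2 hf0, Real.log_pow,
            Real.log_pow, hB]; push_cast; ring
  have h94 : Real.log (9 / 4 : ℝ) ≤ 1 := by
    have : Real.log (9 / 4 : ℝ) ≤ 9 / 4 - 1 := Real.log_le_sub_one_of_pos (by norm_num)
    have h2 : (9 : ℝ) / 4 ≤ Real.exp 1 := by have := Real.exp_one_gt_d9; linarith
    calc Real.log (9 / 4 : ℝ) ≤ Real.log (Real.exp 1) := Real.log_le_log (by norm_num) h2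
      _ = 1 := Real.log_exp 1
  have h6 : 1 + Real.log (1 + P.YRK κ lev / P.Tf lev' ν') ≤ P.WN + Real.log P.N + Real.log ((κ : ℝ) * n) + 3 * Real.log ((n : ℝ) + 2) + 1 := by
    unfold WN; linarith
  exact mul_le_mul_of_nonneg_left h6 hT0.le


/-! ### The START height (κ-form) -/

set_option maxHeartbeats 400000 in
/-- **κ-twin of `logAmaxRR_le`**:
`logAmaxRRK κ ≤ T₀·(WN + 2·log N + log(κn) + 3·log(n+2) + 10n + 30) + (23/160)·T₀·X + (14/100 + n/(4(n+1)))·Z + debris`.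
[cite: Nesterenko2003, §3.5 (3.37), Prop. 3.9; shape only] -/
theorem logAmaxRRK_le (κ : ℕ) (hκ : 1 ≤ κ) (hn2 : 2 ≤ n) : P.logAmaxRRK κ ≤
    (P.Tf 0 0 : ℝ) * (P.WN + 2 * Real.log P.N + Real.log ((κ : ℝ) * n) + 3 * Real.log ((n : ℝ) + 2) + 10 * n + 30) +
      23 / 160 * (P.Tf 0 0 : ℝ) * P.X + (14 / 100 + n / (4 * ((n : ℝ) + 1))) * P.Z +
      ((P.X : ℝ) / 8 + 10 * n + 36 + Real.log P.N + 2 * P.SAR + P.wl 0 * P.X + P.Z / 2 ^ 21) := by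
  have hmid := P.logAmaxRR_mid_le hn2
  have hbox := P.logAmaxRR_box_le
  obtain ⟨-, -, -, hNf00, -⟩ := P.nodes_le 0 0
  have hD := P.logDΔCK_le κ hκ 0 0 0
  have hwl := (P.wl_facts 0).2
  have hY0 := (P.YRK_le κ hκ 0).1
  have h1 : (P.Tf 0 0 : ℝ) * (1 + Real.log (1 + P.YRK κ 0 / (P.Tf 0 0 : ℕ))) ≤
      P.Tf 0 0 * (P.WN + Real.log P.N + Real.log ((κ : ℝ) * n) + 3 * Real.log ((n : ℝ) + 2) + 1) := by
    rw [← ArchG3Setup.log_DΔC hY0]; exact hD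
  have h7 : P.wl 0 * ((P.Nf 0 0 : ℕ) : ℝ) ≤ P.wl 0 * P.X := mul_le_mul_of_nonneg_left hNf00 hwl.le
  have e : (14 / 100 + n / (4 * ((n : ℝ) + 1))) * P.Z = 14 / 100 * P.Z + n / (4 * ((n : ℝ) + 1)) * P.Z := by ring
  unfold logAmaxRRK SAR
  linarith only [hmid, hbox, h1, h7, e]

/-! ### The print size (κ-form) -/

set_option maxHeartbeats 400000 in
/-- **`cPRK κ ≤ (51/25)·Z`** for `n ≥ 2`, given `log(κ·n) ≤ X/32`. [folklore] -/
theorem cPRK_le (κ : ℕ) (hκ : 1 ≤ κ) (hn2 : 2 ≤ n) (hlogκ : Real.log ((κ : ℝ) * n) ≤ P.X / 32) :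
    P.cPRK κ ≤ 51 / 25 * P.Z := by
  have hA := P.logAmaxRRK_le κ hκ hn2
  have hf0 : 0 ≤ Real.log ((κ : ℝ) * n) := Real.log_nonneg (ArchG3Rec.kappa_pred_le hκ P.hn).2.2
  have hC := P.print_core_le hn2 hf0 hlogκ
  obtain ⟨hU, -⟩ := P.cUR_le
  have hJ := P.junk_le
  have hZ0 := P.Z_floors.1
  have hy := yloadK_ge P.hn
  have hy0 := yloadK_pos n
  have hlog := P.N_facts.2.2
  have hp5 : P.Z / (4 * yloadK n) ≤ P.Z / 392 := by
    apply div_le_div_of_nonneg_left hZ0.le (by norm_num)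
    rw [G_eq] at hy
    have hn : (2 : ℝ) ≤ n := by exact_mod_cast hn2
    linarith
  have hl2 : Real.log 2 ≤ 1 := by have := Real.log_two_lt_d9; linarith
  unfold cPRK
  linarith only [hA, hC, hU, hJ, hp5, hl2, hlog, hZ0]

/-- **`cPRK (2^(n−1)) ≤ (51/25)·Z`** for `n ≥ 2` — the shaped frame's `κ = 2^{n−1}` makes the box letter `log(κ·n) ≤ 1.7n ≤ X/32`
unconditional (`X ≥ 64(n+1)`). [folklore] -/
theorem cPRK_two_pow_le (hn2 : 2 ≤ n) : P.cPRK (2 ^ (n - 1)) ≤ 51 / 25 * P.Z := by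
  have hκ : 1 ≤ 2 ^ (n - 1) := Nat.one_le_two_pow
  apply P.cPRK_le (2 ^ (n - 1)) hκ hn2
  have hX : 64 * ((n : ℝ) + 1) ≤ P.X := by exact_mod_cast P.X_floors.1
  have hn : (2 : ℝ) ≤ n := by exact_mod_cast hn2
  have hn0 : (0 : ℝ) < n := by linarith
  have hl2 : Real.log 2 ≤ 1 := by have := Real.log_two_lt_d9; linarith
  have h1 : Real.log (((2 ^ (n - 1) : ℕ) : ℝ) * n) = (n - 1 : ℕ) * Real.log 2 + Real.log n := by
    push_cast
    rw [Real.log_mul (by positivity) hn0.ne', Real.log_pow]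
  have h2 : Real.log (n : ℝ) ≤ n - 1 := Real.log_le_sub_one_of_pos hn0
  have h3 : ((n - 1 : ℕ) : ℝ) = n - 1 := by rw [Nat.cast_sub (by omega)]; simp
  rw [h1, h3]
  have hl0 : 0 ≤ Real.log 2 := Real.log_nonneg one_le_two
  nlinarith

end ArchG3Rec

end Summit.ABC.StewartYu
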